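import Summits.HodgeConjecture.HodgeConjecture.Theorems.H413E2SWFibreCoeffBound
import Summits.HodgeConjecture.HodgeConjecture.Theorems.H413E2SWBorelBound
import Literature.NumberTheory.Weil1965.ThetaIntegralOrbitFunctionalComplex
import Literature.NumberTheory.Weil1965.ThetaIntegralOrbitFunctionalSupport
import Literature.NumberTheory.Weil1965.AdelicSiegelFunctionalLinear
import Literature.NumberTheory.Automorphic.LocalPiSchwartzBruhatFourier
import Literature.NumberTheory.Automorphic.AddCharConductorExponent
import HarnessLib

/-!
# H413 · E-2 · SW2 (iii) — I-CLOSE step (S-1): THE DILATE BOUNDS `hbd` of the fibre differences `μ″_b = μ̂_b − κ₀ μ_b` (Weil's (39))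

Cell `hodgecm-mathlib`, crux H413 (`stmt-HodgeConjecture-24833`), child line `Cruxes/H413/Lines/F0_E2SiegelWeilWeilRange.lean`, stub
`stub_SW2iii_siegelWeil`, identity half; socket map F0P4-plan (g4) 2026-08-31T04:38Z: (BOUND) enters the I-CLOSE ONLY here.
PROOF lane, `--supports stmt-HodgeConjecture-24833 --as helper`.  Seat F0P4-p05 (g2).  KERNEL MATHEMATICS ONLY (one theorem; no definition,
no `sorry`).  HC_CM is proved only modulo the 7 printed citations until rung 0 closes; nothing in this file is about Hodge classes.

THE MATHEMATICS ([Weil1965] Chap. V n° 50, proof of Thm. 4, (39) p. 74; n° 51).  Let `E″ = Λ_θ − κ₀ E_X` be the difference of the theta-side orbit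
functional and Weil's Eisenstein functional on `𝒮(X□(𝔸_F))`; both are positive Radon measures carried by the rational fibres of the norm
`h = q_S`, `Λ_θ = Σ_b μ̂_b`, `E_X = Σ_b μ_b`.  Suppose (BOUND) = (**)′: for every `Φ`, `‖E″(ω(p)Φ)‖ ≤ M_Φ √L(p)` for every `p ∈ Mp` over the Siegel
parabolic ("Borel") of the `W□`-member `U_D` (★ `E2SWBorelBound.exists_borelBound_of_lemma20`, A4 `exists_borelBound_frame`), and the two FRAME
LETTERS: (L-N) the unipotent radical lifts ISOMETRICALLY to the chirps `chirp(β • S)`, `β ∈ 𝔸_F`; (L-D-v) at a finite place `v` split in `E`, in a frame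
`fr = (β_v × id) ∘ placeSplitting⁻¹ : X□(𝔸) ≃ (K^κ × K^κ) × X□(𝔸)^{(v)}`, the Levi element `D(s)` lifts to the dilation of the `x`-half `z.1.1 ↦ s⁻¹ z.1.1`
with `L = |s|^{|κ|}`.  Then for every `b`, every compactly supported `0 ≤ Θ ∈ 𝒮_ℝ`, every `t ∈ X□(F_v)`: along `s_k = ϖ^{-k}`,
`|μ̂_b(f_k) − κ₀ μ_b(f_k)| ≤ M |s_k|^{|κ|/2}` for the dilated pure tensors `f_k = 𝟙_{D(s_k) × D(0)} ⊗ Θ(t, ·)` — Weil's (39) with `γ = |κ|/2 < |κ| − 1`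
(`|κ| = n ≥ 3`).  PROOF: `f_k = ω(D(s_k)) f_0` (L-D-v); `E″(chirp(β•S) f_k) = E″(ω(n_β D(s_k)) f_0)` is bounded by `M_{f_0} |s_k|^{|κ|/2}` for ALL `β`
((**)′ + (L-N), `L` multiplicative, `rowSum_mul`); ★ `E2SWFibreCoeffBound.abs_integral_sub_mul_integral_fibreMeasure_le` (COEFF-b for the difference)
extracts the `b`-th coefficient; ★ `toReal_setLIntegral_map_frame_eq_integral` reads the letter's masses.
ED. 2 (§6–§7, glue atoms for the letters feeding `hLD`): `l2Scaling_eq_of_omega_eq_twistLM` (`ω q = twistLM g ⇒ L q = |det g⁻¹|_𝔸`) and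
`rowSum_conj_of_diag` (the Cayley conjugate `M·D·M⁻¹` of a diagonal `D` satisfies the row-sum = Siegel-parabolic condition).

References: A. Weil, *Sur la formule de Siegel dans la théorie des groupes classiques*, Acta Math. 113 (1965), Chap. V n° 50 (39)–(40) p. 74,
n° 51 pp. 75–76 [Weil1965]; A. Weil, *Sur certains groupes d'opérateurs unitaires*, Acta Math. 111 (1964), Chap. I n° 13 [Weil1964].
-/

set_option autoImplicit false
-- the cell's `Summit.HodgeConjecture.HodgeConjecture.…` namespace repeats the summit name by design (D-0017 layout)
set_option linter.dupNamespace false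

noncomputable section

open MeasureTheory NumberField Filter Topology Set IsDedekindDomain
open scoped NNReal ENNReal Matrix ComplexConjugate
open Literature.NumberTheory.Automorphic Literature.NumberTheory.Automorphic.AdelicVector
open Literature.NumberTheory.Weil1964 Literature.NumberTheory.Weil1965 Literature.NumberTheory.Weil1965.UnitaryDoubling
open Literature.NumberTheory.GaloisRepresentations.IsNonarchimedeanLocalField
open Literature.RepresentationTheory.HeisenbergGroup
open Summit.HodgeConjecture.HodgeConjecture.Cruxes.H413.E2SWFibreCoeffBound

namespace Summit.HodgeConjecture.HodgeConjecture.Cruxes.H413.E2SWDilateBoundCM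

/-! ## §5 The letter `hbd` at the CM ∕ unitary dual pair from (**)′ and the frame letters -/

section Main

variable (F E : Type) [Field F] [NumberField F] [Field E] [NumberField E] [Algebra F E] [Algebra.IsQuadraticExtension F E]
  (c : E ≃ₐ[F] E) {δ : E} (hcδ : c δ = -δ) (hδ : δ ≠ 0) {d : F} (hd : δ * δ = algebraMap F E d)
  (N : ℕ) {n : ℕ} (e : Fin N × Fin 1 ≃ Fin n)
  (TV : Matrix (Fin N) (Fin N) F) (hV : TV.IsSymm) (hVd : IsUnit TV.det)
  (TW : Matrix (Fin 1) (Fin 1) F) (hW : TW.IsSymm) (hWd : IsUnit TW.det)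
  [LocallyCompactSpace (UnitaryGroup.adelic F E c N (TV.map (algebraMap F E)))]
  [CompactSpace (UnitaryGroup.adelic F E c N (TV.map (algebraMap F E)) ⧸ (UnitaryGroup.toAdelic F E c N (TV.map (algebraMap F E))).range)]
  [MeasurableSpace (UnitaryGroup.adelic F E c N (TV.map (algebraMap F E)) ⧸ (UnitaryGroup.toAdelic F E c N (TV.map (algebraMap F E))).range)]
  [BorelSpace (UnitaryGroup.adelic F E c N (TV.map (algebraMap F E)) ⧸ (UnitaryGroup.toAdelic F E c N (TV.map (algebraMap F E))).range)]
  (ν : Measure (UnitaryGroup.adelic F E c N (TV.map (algebraMap F E)) ⧸ (UnitaryGroup.toAdelic F E c N (TV.map (algebraMap F E))).range))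
  [IsFiniteMeasure ν]
  [MeasurableSpace (adeleQuotient F)] [BorelSpace (adeleQuotient F)]
  [MeasurableSpace (AdeleRing (𝓞 F) F)] [BorelSpace (AdeleRing (𝓞 F) F)]
  (νX : Measure (Fin (n + n) → AdeleRing (𝓞 F) F)) [νX.IsAddHaarMeasure]
  (h : (Fin (n + n) → AdeleRing (𝓞 F) F) → AdeleRing (𝓞 F) F) (hh : Continuous h)

/-- **(S-1) `hbd_CM` — WEIL'S (39): THE DILATE BOUNDS OF `μ″_b = μ̂_b − κ₀ μ_b` ALONG `‖s_k‖ → ∞` WITH EXPONENT `|κ|/2 < |κ| − 1`.**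
The `hbd` binder of ★-track (T1) `E2SWIdentityClose.doubledThetaIntegral_eq_mul_eis_of_frame` (rf f5d20bc2 :275–:282) ∕ ★ (T3)
`E2SWIdentityCloseFibre.integral_fibreMeasure_eq_smul_of_splitPlaceFrame`, VERBATIM, for the theta-side fibre measures of `Λ_θ,ℝ` and Weil's `μ_b`,
at a frame `(β_v, fr, he1, he2)` of a finite place `v` with `3 ≤ |κ|`.  BINDERS in the metaplectic currency `Mp = adelicMpCont F (Fin (n+n)) 𝕋`,
`L = l2Scaling`, an abstract `j : UnitaryGroup.adelic F E c (1 + 1)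
        ((Matrix.reindex finSumFinEquiv finSumFinEquiv (Matrix.fromBlocks TW 0 0 (-TW))).map (algebraMap F E)) →* Sp`: `hE''` (`E″ = Λ_θ − κ₀ E_X` on `𝒮`, `κ₀ = ν(univ)`), **`hBOUND`** = (**)′ for every `Φ`
(★ `E2SWBorelBound.exists_borelBound_of_lemma20` ∕ A4 `exists_borelBound_frame`), **`hLN`** = the unipotent radical of the Siegel parabolic lifts
isometrically to the chirps `chirp(β • S)` of the norm `h = q_S` (frame letter (L-N)), **`hLD`** = the Levi dilations at `v`: `z.1.1 ↦ s⁻¹ z.1.1` in the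
frame, with `L = ‖s‖ ^ |κ|` (frame letter (L-D-v)).  The sequence is `s_k = ϖ ^ (-k)`, `M` the (**)′ constant of the base tensor
`f₀ = 𝟙(β_v⁻¹(D₀ × D₀)) ⊗ Θ(t,·)`, `γ = |κ|/2`.
[cite: Weil1965, Chap. V n° 50, (39) p. 74; n° 51] [cite: Weil1964, Chap. I n° 13 p. 160] -/
theorem hbd_CM
    (hhN : ∀ x, h x = hNorm F E c hcδ hδ N e TV hVd TW hWd x)
    (hB : ∀ Φ ∈ piSchwartzBruhat F (Fin (n + n)), Summable fun ξ : F => ‖adelicSiegelCoeff F (Fin (n + n)) νX h Φ ξ‖)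
    (Smat : Matrix (Fin (n + n)) (Fin (n + n)) (AdeleRing (𝓞 F) F))
    (hhS : ∀ x, h x = Literature.NumberTheory.Weil1964.sdForm F Smat x)
    (𝕋 : Matrix (Fin (n + n)) (Fin (n + n)) (AdeleRing (𝓞 F) F)) (h𝕋 : IsUnit 𝕋.det)
    (j : ↥(UnitaryGroup.adelic F E c (1 + 1)
        ((Matrix.reindex finSumFinEquiv finSumFinEquiv (Matrix.fromBlocks TW 0 0 (-TW))).map (algebraMap F E))) →*
      ↥(symplecticGroup (polar (adelicForm F (Fin (n + n)) 𝕋))))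
    (E'' : piSchwartzBruhat F (Fin (n + n)) →ₗ[ℂ] ℂ)
    (hE'' : ∀ Ψ : piSchwartzBruhat F (Fin (n + n)), E'' Ψ = thetaOrbitFunctional F E c hcδ hδ hd N e TV hV hVd TW hW hWd ν Ψ -
      ((ν Set.univ).toReal : ℂ) * adelicSiegelFunctionalC F (Fin (n + n)) νX h hh hB Ψ)
    (hBOUND : ∀ Φ : piSchwartzBruhat F (Fin (n + n)), ∃ Mbound : ℝ,
      ∀ (p : adelicMpCont F (Fin (n + n)) 𝕋) (b : GL (Fin (1 + 1)) (AdeleRing (𝓞 E) E))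
        (hb : b ∈ UnitaryGroup.adelic F E c (1 + 1)
        ((Matrix.reindex finSumFinEquiv finSumFinEquiv (Matrix.fromBlocks TW 0 0 (-TW))).map (algebraMap F E))),
        (b : Matrix (Fin (1 + 1)) (Fin (1 + 1)) (AdeleRing (𝓞 E) E)) 0 0 + (b : Matrix (Fin (1 + 1)) (Fin (1 + 1)) (AdeleRing (𝓞 E) E)) 0 1 =
          (b : Matrix (Fin (1 + 1)) (Fin (1 + 1)) (AdeleRing (𝓞 E) E)) 1 0 + (b : Matrix (Fin (1 + 1)) (Fin (1 + 1)) (AdeleRing (𝓞 E) E)) 1 1 →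
        adelicMpCont.proj F (Fin (n + n)) 𝕋 p = j ⟨b, hb⟩ →
        ‖E'' (adelicMpCont.omega F (Fin (n + n)) 𝕋 p Φ)‖ ≤ Mbound * Real.sqrt (adelicMpCont.l2Scaling F 𝕋 h𝕋 νX p).toReal)
    (hLN : ∀ β : AdeleRing (𝓞 F) F, ∃ (q : adelicMpCont F (Fin (n + n)) 𝕋) (u : GL (Fin (1 + 1)) (AdeleRing (𝓞 E) E))
        (hu : u ∈ UnitaryGroup.adelic F E c (1 + 1)
        ((Matrix.reindex finSumFinEquiv finSumFinEquiv (Matrix.fromBlocks TW 0 0 (-TW))).map (algebraMap F E))),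
        ((u : Matrix (Fin (1 + 1)) (Fin (1 + 1)) (AdeleRing (𝓞 E) E)) 0 0 + (u : Matrix (Fin (1 + 1)) (Fin (1 + 1)) (AdeleRing (𝓞 E) E)) 0 1 =
          (u : Matrix (Fin (1 + 1)) (Fin (1 + 1)) (AdeleRing (𝓞 E) E)) 1 0 + (u : Matrix (Fin (1 + 1)) (Fin (1 + 1)) (AdeleRing (𝓞 E) E)) 1 1) ∧
        adelicMpCont.proj F (Fin (n + n)) 𝕋 q = j ⟨u, hu⟩ ∧ adelicMpCont.l2Scaling F 𝕋 h𝕋 νX q = 1 ∧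
        ∀ Ψ : piSchwartzBruhat F (Fin (n + n)), adelicMpCont.omega F (Fin (n + n)) 𝕋 q Ψ = chirpLM F (β • Smat) Ψ)
    (v : HeightOneSpectrum (𝓞 F))
    {K : Type*} [Field K] [ValuativeRel K] [TopologicalSpace K] [IsNonarchimedeanLocalField K] [MeasurableSpace K] [BorelSpace K]
    {κ : Type*} [Fintype κ] (hκ : 3 ≤ Fintype.card κ)
    (βv : (Fin (n + n) → v.adicCompletion F) ≃ₜ ((κ → K) × (κ → K)))
    (fr : (Fin (n + n) → AdeleRing (𝓞 F) F) ≃ₜ (((κ → K) × (κ → K)) × trivialAt F (Fin (n + n)) v))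
    (he1 : ∀ x, (fr x).1 = βv (evalAt F (Fin (n + n)) v x))
    (he2 : ∀ x, (fr x).2 = ((placeSplitting F (Fin (n + n)) v).symm x).2)
    (hLD : ∀ s : K, s ≠ 0 → ∃ (q : adelicMpCont F (Fin (n + n)) 𝕋) (u : GL (Fin (1 + 1)) (AdeleRing (𝓞 E) E))
        (hu : u ∈ UnitaryGroup.adelic F E c (1 + 1)
        ((Matrix.reindex finSumFinEquiv finSumFinEquiv (Matrix.fromBlocks TW 0 0 (-TW))).map (algebraMap F E))),
        ((u : Matrix (Fin (1 + 1)) (Fin (1 + 1)) (AdeleRing (𝓞 E) E)) 0 0 + (u : Matrix (Fin (1 + 1)) (Fin (1 + 1)) (AdeleRing (𝓞 E) E)) 0 1 =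
          (u : Matrix (Fin (1 + 1)) (Fin (1 + 1)) (AdeleRing (𝓞 E) E)) 1 0 + (u : Matrix (Fin (1 + 1)) (Fin (1 + 1)) (AdeleRing (𝓞 E) E)) 1 1) ∧
        adelicMpCont.proj F (Fin (n + n)) 𝕋 q = j ⟨u, hu⟩ ∧
        adelicMpCont.l2Scaling F 𝕋 h𝕋 νX q = ((normAbs K s : ℝ≥0) : ℝ≥0∞) ^ Fintype.card κ ∧
        ∀ (Ψ : piSchwartzBruhat F (Fin (n + n))) (x : Fin (n + n) → AdeleRing (𝓞 F) F),
          ((adelicMpCont.omega F (Fin (n + n)) 𝕋 q Ψ : piSchwartzBruhat F (Fin (n + n))) : (Fin (n + n) → AdeleRing (𝓞 F) F) → ℂ) x =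
            (Ψ : (Fin (n + n) → AdeleRing (𝓞 F) F) → ℂ) (fr.symm (((s⁻¹ • (fr x).1.1, (fr x).1.2)), (fr x).2))) :
    ∀ (b : F) (Θ : piSchwartzBruhatReal F (Fin (n + n))), 0 ≤ (Θ : (Fin (n + n) → AdeleRing (𝓞 F) F) → ℝ) → HasCompactSupport (Θ : (Fin (n + n) → AdeleRing (𝓞 F) F) → ℝ) →
      ∀ t : Fin (n + n) → v.adicCompletion F, ∃ (s : ℕ → K) (M γ : ℝ), (∀ k, s k ≠ 0) ∧
        Tendsto (fun k => (normAbs K (s k) : ℝ)) atTop atTop ∧ γ < (Fintype.card κ : ℝ) - 1 ∧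
        ∀ k, |(∫⁻ z in {z : (κ → K) × (κ → K) | ((s k)⁻¹ • z.1, z.2) ∈ piPrimePowBall K κ 0 ×ˢ piPrimePowBall K κ 0} ×ˢ (univ : Set (trivialAt F (Fin (n + n)) v)),
              ENNReal.ofReal ((Θ : (Fin (n + n) → AdeleRing (𝓞 F) F) → ℝ) (AdelicVector.placeSplitting F (Fin (n + n)) v (t, z.2))) ∂((fibreMeasure F (Fin (n + n)) (thetaOrbitFunctionalReal F E c hcδ hδ hd N e TV hV hVd TW hW hWd ν) (thetaOrbitFunctionalReal_nonneg F E c hcδ hδ hd N e TV hV hVd TW hW hWd ν) h b).map fr)).toReal -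
            ((ν Set.univ).toReal : ℝ) * (∫⁻ z in {z : (κ → K) × (κ → K) | ((s k)⁻¹ • z.1, z.2) ∈ piPrimePowBall K κ 0 ×ˢ piPrimePowBall K κ 0} ×ˢ (univ : Set (trivialAt F (Fin (n + n)) v)),
              ENNReal.ofReal ((Θ : (Fin (n + n) → AdeleRing (𝓞 F) F) → ℝ) (AdelicVector.placeSplitting F (Fin (n + n)) v (t, z.2))) ∂((adelicSiegelFibreMeasure F (Fin (n + n)) νX h hh hB b).map fr)).toReal|
          ≤ M * (normAbs K (s k) : ℝ) ^ γ := by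
  intro b Θ hΘ0 hΘc t
  classical
  haveI : SecondCountableTopology K := secondCountableTopology_localField K
  haveI : T2Space K := (isLocalField K).toT2Space
  haveI := secondCountableTopology_adeleRing (K := F)
  haveI : BorelSpace (Fin (n + n) → AdeleRing (𝓞 F) F) := Pi.borelSpace
  haveI := regular_schwartzBruhatMeasure F (Fin (n + n)) (thetaOrbitFunctionalReal F E c hcδ hδ hd N e TV hV hVd TW hW hWd ν) (thetaOrbitFunctionalReal_nonneg F E c hcδ hδ hd N e TV hV hVd TW hW hWd ν)
  haveI := regular_schwartzBruhatMeasure F (Fin (n + n)) (adelicSiegelFunctional F (Fin (n + n)) νX h hh hB)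
    (fun Ψ hΨ => (adelicSiegelFunctional_nonneg hh hB Ψ hΨ).1)
  haveI : IsFiniteMeasureOnCompacts (fibreMeasure F (Fin (n + n)) (thetaOrbitFunctionalReal F E c hcδ hδ hd N e TV hV hVd TW hW hWd ν) (thetaOrbitFunctionalReal_nonneg F E c hcδ hδ hd N e TV hV hVd TW hW hWd ν) h b) := by
    unfold fibreMeasure; infer_instance
  haveI : IsFiniteMeasureOnCompacts (adelicSiegelFibreMeasure F (Fin (n + n)) νX h hh hB b) := by
    unfold adelicSiegelFibreMeasure fibreMeasure; infer_instance
  -- the escaping sequence `s_k = ϖ^(-k)`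
  obtain ⟨ϖ, hϖ0, hϖ⟩ := exists_normAbs_eq_inv (F := K)
  obtain ⟨s, hs_def⟩ : ∃ s : ℕ → K, s = fun k => ϖ⁻¹ ^ k := ⟨_, rfl⟩
  have hs0 : ∀ k, s k ≠ 0 := fun k => by rw [hs_def]; exact pow_ne_zero _ (inv_ne_zero hϖ0)
  have hsn : ∀ k, (normAbs K (s k) : ℝ) = ((residueFieldCard K : ℝ≥0) : ℝ) ^ k := fun k => by
    rw [hs_def]; simp only [map_pow, map_inv₀, hϖ, inv_inv, NNReal.coe_pow]
  have hst : Tendsto (fun k => (normAbs K (s k) : ℝ)) atTop atTop := by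
    simp_rw [hsn]
    exact tendsto_pow_atTop_atTop_of_one_lt (by exact_mod_cast one_lt_residueFieldCard_nnreal (F := K))
  -- the boxes `A_k = {z | (s_k⁻¹ z.1, z.2) ∈ D₀ × D₀}` are compact open
  have hAk : ∀ k, IsOpen {z : (κ → K) × (κ → K) | ((s k)⁻¹ • z.1, z.2) ∈ piPrimePowBall K κ 0 ×ˢ piPrimePowBall K κ 0} ∧ IsCompact {z : (κ → K) × (κ → K) | ((s k)⁻¹ • z.1, z.2) ∈ piPrimePowBall K κ 0 ×ˢ piPrimePowBall K κ 0} := by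
    intro k
    have hDo : IsOpen (piPrimePowBall K κ 0 ×ˢ piPrimePowBall K κ 0) := (isOpen_piPrimePowBall 0).prod (isOpen_piPrimePowBall 0)
    have hDc : IsCompact (piPrimePowBall K κ 0 ×ˢ piPrimePowBall K κ 0) := (isCompact_piPrimePowBall 0).prod (isCompact_piPrimePowBall 0)
    let φ : ((κ → K) × (κ → K)) ≃ₜ ((κ → K) × (κ → K)) :=
      (Homeomorph.smulOfNeZero (s k)⁻¹ (inv_ne_zero (hs0 k))).prodCongr (Homeomorph.refl _)
    exact ⟨hDo.preimage φ.continuous, φ.isCompact_preimage.2 hDc⟩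
  -- the base tensor `f₀ = 𝟙(β_v⁻¹(D₀ × D₀)) ⊗ Θ(t, ·)` and its (**)′ constant
  have hA0o : IsOpen (βv ⁻¹' (piPrimePowBall K κ 0 ×ˢ piPrimePowBall K κ 0)) :=
    ((isOpen_piPrimePowBall 0).prod (isOpen_piPrimePowBall 0)).preimage βv.continuous
  have hA0c : IsCompact (βv ⁻¹' (piPrimePowBall K κ 0 ×ˢ piPrimePowBall K κ 0)) :=
    βv.isCompact_preimage.2 ((isCompact_piPrimePowBall 0).prod (isCompact_piPrimePowBall 0))
  obtain ⟨f₀, hf₀_def⟩ : ∃ f₀ : (Fin (n + n) → AdeleRing (𝓞 F) F) → ℝ, f₀ = fun x =>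
      (βv ⁻¹' (piPrimePowBall K κ 0 ×ˢ piPrimePowBall K κ 0)).indicator (fun _ => (1 : ℝ)) (evalAt F (Fin (n + n)) v x) *
        (Θ : (Fin (n + n) → AdeleRing (𝓞 F) F) → ℝ) (placeSplitting F (Fin (n + n)) v (t, ((placeSplitting F (Fin (n + n)) v).symm x).2)) := ⟨_, rfl⟩
  have hf₀ : f₀ ∈ piSchwartzBruhatReal F (Fin (n + n)) := by
    rw [hf₀_def]; exact indicator_evalAt_mul_slice_mem_piSchwartzBruhatReal Θ.2 t hA0o hA0c
  obtain ⟨Φ₀, hΦ₀⟩ : ∃ Φ₀ : piSchwartzBruhat F (Fin (n + n)), (Φ₀ : (Fin (n + n) → AdeleRing (𝓞 F) F) → ℂ) = fun x => ((f₀ x : ℝ) : ℂ) :=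
    ⟨⟨_, mem_piSchwartzBruhatReal_iff.1 hf₀⟩, rfl⟩
  obtain ⟨Mb, hMb⟩ := hBOUND Φ₀
  refine ⟨s, Mb, (Fintype.card κ : ℝ) / 2, hs0, hst, ?_, fun k => ?_⟩
  · have h3 : (3 : ℝ) ≤ (Fintype.card κ : ℝ) := by exact_mod_cast hκ
    linarith
  -- level `k`: the dilation `D(s_k)` and the dilated tensor `f_k = ω(D(s_k)) f₀`
  obtain ⟨q, u, hu, hurow, hqproj, hqL, hqω⟩ := hLD (s k) (hs0 k)
  have hfk : (fun x => (βv ⁻¹' {z : (κ → K) × (κ → K) | ((s k)⁻¹ • z.1, z.2) ∈ piPrimePowBall K κ 0 ×ˢ piPrimePowBall K κ 0}).indicator (fun _ => (1 : ℝ)) (evalAt F (Fin (n + n)) v x) *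
      (Θ : (Fin (n + n) → AdeleRing (𝓞 F) F) → ℝ) (placeSplitting F (Fin (n + n)) v (t, ((placeSplitting F (Fin (n + n)) v).symm x).2))) ∈
      piSchwartzBruhatReal F (Fin (n + n)) :=
    indicator_evalAt_mul_slice_mem_piSchwartzBruhatReal Θ.2 t ((hAk k).1.preimage βv.continuous) (βv.isCompact_preimage.2 (hAk k).2)
  have hfkc : HasCompactSupport (fun x => (βv ⁻¹' {z : (κ → K) × (κ → K) | ((s k)⁻¹ • z.1, z.2) ∈ piPrimePowBall K κ 0 ×ˢ piPrimePowBall K κ 0}).indicator (fun _ => (1 : ℝ)) (evalAt F (Fin (n + n)) v x) *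
      (Θ : (Fin (n + n) → AdeleRing (𝓞 F) F) → ℝ) (placeSplitting F (Fin (n + n)) v (t, ((placeSplitting F (Fin (n + n)) v).symm x).2))) :=
    hasCompactSupport_indicator_evalAt_mul_slice hΘc t (βv.isCompact_preimage.2 (hAk k).2)
  have hωq : ((adelicMpCont.omega F (Fin (n + n)) 𝕋 q Φ₀ : piSchwartzBruhat F (Fin (n + n))) : (Fin (n + n) → AdeleRing (𝓞 F) F) → ℂ) = fun x =>
      (((βv ⁻¹' {z : (κ → K) × (κ → K) | ((s k)⁻¹ • z.1, z.2) ∈ piPrimePowBall K κ 0 ×ˢ piPrimePowBall K κ 0}).indicator (fun _ => (1 : ℝ)) (evalAt F (Fin (n + n)) v x) *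
        (Θ : (Fin (n + n) → AdeleRing (𝓞 F) F) → ℝ) (placeSplitting F (Fin (n + n)) v (t, ((placeSplitting F (Fin (n + n)) v).symm x).2)) : ℝ) : ℂ) := by
    funext x
    rw [hqω Φ₀ x, hΦ₀]
    dsimp only
    congr 1
    have hy1 : evalAt F (Fin (n + n)) v (fr.symm (((s k)⁻¹ • (fr x).1.1, (fr x).1.2), (fr x).2)) =
        βv.symm ((s k)⁻¹ • (fr x).1.1, (fr x).1.2) := by
      apply βv.injective
      rw [← he1 (fr.symm _), Homeomorph.apply_symm_apply, Homeomorph.apply_symm_apply]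
    have hy2 : ((placeSplitting F (Fin (n + n)) v).symm (fr.symm (((s k)⁻¹ • (fr x).1.1, (fr x).1.2), (fr x).2))).2 =
        ((placeSplitting F (Fin (n + n)) v).symm x).2 := by
      rw [← he2 (fr.symm _), Homeomorph.apply_symm_apply, he2 x]
    rw [hf₀_def]
    dsimp only
    rw [hy1, hy2]
    congr 1
    by_cases hmem : ((s k)⁻¹ • (fr x).1.1, (fr x).1.2) ∈ piPrimePowBall K κ 0 ×ˢ piPrimePowBall K κ 0
    · rw [Set.indicator_of_mem (show βv.symm ((s k)⁻¹ • (fr x).1.1, (fr x).1.2) ∈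
            βv ⁻¹' (piPrimePowBall K κ 0 ×ˢ piPrimePowBall K κ 0) by
          rw [Set.mem_preimage, Homeomorph.apply_symm_apply]; exact hmem),
        Set.indicator_of_mem (show evalAt F (Fin (n + n)) v x ∈ βv ⁻¹' {z : (κ → K) × (κ → K) | ((s k)⁻¹ • z.1, z.2) ∈ piPrimePowBall K κ 0 ×ˢ piPrimePowBall K κ 0} by
          rw [Set.mem_preimage, Set.mem_setOf_eq, ← he1 x]; exact hmem)]
    · rw [Set.indicator_of_notMem (fun h' => hmem (by
            rw [Set.mem_preimage, Homeomorph.apply_symm_apply] at h'; exact h')),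
        Set.indicator_of_notMem (fun h' => hmem (by
            rw [Set.mem_preimage, Set.mem_setOf_eq, ← he1 x] at h'; exact h'))]
  -- (**)′ + (L-N): `‖E″(chirp(β•S) f_k)‖ = ‖E″(ω(n_β D(s_k)) f₀)‖ ≤ M_b ‖s_k‖^(|κ|/2)` for ALL `β`
  have hM : ∀ β : AdeleRing (𝓞 F) F, ‖E'' (chirpLM F (β • Smat) (adelicMpCont.omega F (Fin (n + n)) 𝕋 q Φ₀))‖ ≤
      Mb * (normAbs K (s k) : ℝ) ^ ((Fintype.card κ : ℝ) / 2) := by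
    intro β
    have hLNβ := hLN β
    obtain ⟨nq, w, hw, hwrow, hnproj, hnL, hnω⟩ := hLNβ
    -- `chirp(β•S) (ω(q) Φ₀) = ω(n_β) (ω(q) Φ₀) = ω(n_β q) Φ₀`
    have h2 : adelicMpCont.omega F (Fin (n + n)) 𝕋 (nq * q) Φ₀ =
        adelicMpCont.omega F (Fin (n + n)) 𝕋 nq (adelicMpCont.omega F (Fin (n + n)) 𝕋 q Φ₀) :=
      (LinearMap.congr_fun (map_mul (adelicMpCont.omega F (Fin (n + n)) 𝕋) nq q) Φ₀).trans (Module.End.mul_apply _ _ _)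
    have hmul : chirpLM F (β • Smat) (adelicMpCont.omega F (Fin (n + n)) 𝕋 q Φ₀) =
        adelicMpCont.omega F (Fin (n + n)) 𝕋 (nq * q) Φ₀ :=
      ((hnω (adelicMpCont.omega F (Fin (n + n)) 𝕋 q Φ₀)).symm.trans h2.symm)
    have hproj' : adelicMpCont.proj F (Fin (n + n)) 𝕋 (nq * q) = j ⟨w * u, Subgroup.mul_mem _ hw hu⟩ :=
      (map_mul (adelicMpCont.proj F (Fin (n + n)) 𝕋) nq q).trans
        ((congrArg₂ (· * ·) hnproj hqproj).trans (map_mul j ⟨w, hw⟩ ⟨u, hu⟩).symm)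
    have hb' := hMb (nq * q) (w * u) (Subgroup.mul_mem _ hw hu) (rowSum_mul w u hwrow hurow) hproj'
    have hL1 : adelicMpCont.l2Scaling F 𝕋 h𝕋 νX (nq * q) = ((normAbs K (s k) : ℝ≥0) : ℝ≥0∞) ^ Fintype.card κ :=
      (adelicMpCont.l2Scaling_mul F 𝕋 h𝕋 νX nq q).trans (by rw [hnL, one_mul, hqL])
    have hL' : Real.sqrt (adelicMpCont.l2Scaling F 𝕋 h𝕋 νX (nq * q)).toReal = (normAbs K (s k) : ℝ) ^ ((Fintype.card κ : ℝ) / 2) := by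
      rw [hL1, ENNReal.toReal_pow, ENNReal.coe_toReal, Real.sqrt_eq_rpow, ← Real.rpow_natCast,
        ← Real.rpow_mul (NNReal.coe_nonneg _)]
      congr 1
      ring
    exact (congrArg (fun Ψ => ‖E'' Ψ‖) hmul).trans_le (hb'.trans (le_of_eq (congrArg (fun r => Mb * r) hL')))
  -- the fibre expansion of `E″` and COEFF-b
  have hE''form : ∀ Ψ : piSchwartzBruhat F (Fin (n + n)), E'' Ψ =
      (((thetaOrbitFunctionalReal F E c hcδ hδ hd N e TV hV hVd TW hW hWd ν) ⟨fun x => ((Ψ : (Fin (n + n) → AdeleRing (𝓞 F) F) → ℂ) x).re, re_mem_piSchwartzBruhatReal Ψ.2⟩ : ℂ) +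
          Complex.I * ((thetaOrbitFunctionalReal F E c hcδ hδ hd N e TV hV hVd TW hW hWd ν) ⟨fun x => ((Ψ : (Fin (n + n) → AdeleRing (𝓞 F) F) → ℂ) x).im, im_mem_piSchwartzBruhatReal Ψ.2⟩ : ℂ)) -
        (((ν Set.univ).toReal : ℝ) : ℂ) *
          ((adelicSiegelFunctional F (Fin (n + n)) νX h hh hB ⟨fun x => ((Ψ : (Fin (n + n) → AdeleRing (𝓞 F) F) → ℂ) x).re, re_mem_piSchwartzBruhatReal Ψ.2⟩ : ℂ) +
            Complex.I * (adelicSiegelFunctional F (Fin (n + n)) νX h hh hB ⟨fun x => ((Ψ : (Fin (n + n) → AdeleRing (𝓞 F) F) → ℂ) x).im, im_mem_piSchwartzBruhatReal Ψ.2⟩ : ℂ)) := by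
    intro Ψ
    rw [hE'' Ψ, thetaOrbitFunctional_eq_re_add_im, adelicSiegelFunctionalC_eq_re_add_im]
  have hS0₁ : ∀ (Ψ : piSchwartzBruhatReal F (Fin (n + n))) (L : Set (Fin (n + n) → AdeleRing (𝓞 F) F)), IsCompact L →
      (∀ x ∈ L, (QuotientAddGroup.mk (h x) : adeleQuotient F) ≠ 0) →
      tsupport (Ψ : (Fin (n + n) → AdeleRing (𝓞 F) F) → ℝ) ⊆ L → (thetaOrbitFunctionalReal F E c hcδ hδ hd N e TV hV hVd TW hW hWd ν) Ψ = 0 :=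
    fun Ψ L hL hL0 hΨL => thetaOrbitFunctionalReal_support F E c hcδ hδ hd N e TV hV hVd TW hW hWd ν Ψ L hL
      (fun x hx => by rw [← hhN x]; exact hL0 x hx) hΨL
  have hcoeff := abs_integral_sub_mul_integral_fibreMeasure_le F (thetaOrbitFunctionalReal F E c hcδ hδ hd N e TV hV hVd TW hW hWd ν) (adelicSiegelFunctional F (Fin (n + n)) νX h hh hB)
    (thetaOrbitFunctionalReal_nonneg F E c hcδ hδ hd N e TV hV hVd TW hW hWd ν) (fun Ψ hΨ => (adelicSiegelFunctional_nonneg hh hB Ψ hΨ).1) h hh hS0₁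
    (adelicSiegelFunctional_eq_zero_of_tsupport_subset F (Fin (n + n)) νX h hh hB) Smat hhS (ν Set.univ).toReal E'' hE''form
    ⟨_, hfk⟩ hfkc (adelicMpCont.omega F (Fin (n + n)) 𝕋 q Φ₀) hωq hM b
  rw [toReal_setLIntegral_map_frame_eq_integral F (Fin (n + n)) v βv fr he1 he2
      (fibreMeasure F (Fin (n + n)) (thetaOrbitFunctionalReal F E c hcδ hδ hd N e TV hV hVd TW hW hWd ν) (thetaOrbitFunctionalReal_nonneg F E c hcδ hδ hd N e TV hV hVd TW hW hWd ν) h b) (hAk k).1 (hAk k).2 Θ hΘ0 hΘc t,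
    toReal_setLIntegral_map_frame_eq_integral F (Fin (n + n)) v βv fr he1 he2
      (adelicSiegelFibreMeasure F (Fin (n + n)) νX h hh hB b) (hAk k).1 (hAk k).2 Θ hΘ0 hΘc t]
  exact hcoeff

end Main

/-! ## §6 (ED. 2) Reading the `L²` scaling off a twist: `ω(q) = twistLM g ⇒ L(q) = |det g⁻¹|_𝔸` -/

section Twist

variable (F : Type) [Field F] [NumberField F] {m : ℕ}
  [MeasurableSpace (AdeleRing (𝓞 F) F)] [BorelSpace (AdeleRing (𝓞 F) F)]
  (νX : Measure (Fin m → AdeleRing (𝓞 F) F)) [νX.IsAddHaarMeasure]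
  (𝕋 : Matrix (Fin m) (Fin m) (AdeleRing (𝓞 F) F)) (h𝕋 : IsUnit 𝕋.det)

/-- **the modulus of a twisting lift**: if `q ∈ Mp` acts on `𝒮(𝔸_F^m)` by the twist `Φ ↦ Φ(· g)` then `L(q) = |det g⁻¹|_𝔸 = |det g|_𝔸⁻¹`
(★ `lintegral_enorm_sq_twist`, ★ `l2Scaling_eq_of_forall`) — the `L q` clause of `hbd_CM`'s `hLD` from the torus letter's `ω q = twistLM Mt`.
[cite: Weil1964, Chap. I n° 13 p. 160] -/
theorem l2Scaling_eq_of_omega_eq_twistLM (q : adelicMpCont F (Fin m) 𝕋) (g : GL (Fin m) (AdeleRing (𝓞 F) F))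
    (hq : ∀ Ψ : piSchwartzBruhat F (Fin m), adelicMpCont.omega F (Fin m) 𝕋 q Ψ = twistLM F g Ψ) :
    adelicMpCont.l2Scaling F 𝕋 h𝕋 νX q = ((adelicAbsDet m F g⁻¹ : ℝ≥0) : ℝ≥0∞) :=
  adelicMpCont.l2Scaling_eq_of_forall F 𝕋 h𝕋 νX q fun Φ => by
    have e : ((adelicMpCont.omega F (Fin m) 𝕋 q Φ : piSchwartzBruhat F (Fin m)) : (Fin m → AdeleRing (𝓞 F) F) → ℂ) =
        twist F g ((Φ : piSchwartzBruhat F (Fin m)) : (Fin m → AdeleRing (𝓞 F) F) → ℂ) := by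
      rw [hq Φ, coe_twistLM]
    rw [e]
    exact lintegral_enorm_sq_twist F νX g _

end Twist

/-! ## §7 (ED. 2) The Cayley-conjugate of a diagonal element stabilises `W^Δ` (row-sum condition) -/

/-- **row-sum of `M · D · M⁻¹`** for a `2×2` unit `M` whose first column is `(1,1)ᵀ` (the Cayley matrix of ★ `DoubledUnitaryRankOneReductionDiag`)
and a lower-left-zero `D` (e.g. diagonal): `u = M D M⁻¹` satisfies `u₀₀ + u₀₁ = u₁₀ + u₁₁` (`u·(1,1)ᵀ = M D e₀ = D₀₀·(1,1)ᵀ`) — the "Borel" hypothesis of (**)′ for the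
Levi elements `d(t)` of the torus letter. [cite: Weil1965, Chap. V n° 47, p. 67] -/
theorem rowSum_conj_of_diag {R : Type*} [CommRing R] (M D : GL (Fin 2) R)
    (hM0 : (M : Matrix (Fin 2) (Fin 2) R) 0 0 = 1) (hM1 : (M : Matrix (Fin 2) (Fin 2) R) 1 0 = 1)
    (hD10 : (D : Matrix (Fin 2) (Fin 2) R) 1 0 = 0) :
    ((M * D * M⁻¹ : GL (Fin 2) R) : Matrix (Fin 2) (Fin 2) R) 0 0 + ((M * D * M⁻¹ : GL (Fin 2) R) : Matrix (Fin 2) (Fin 2) R) 0 1 =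
      ((M * D * M⁻¹ : GL (Fin 2) R) : Matrix (Fin 2) (Fin 2) R) 1 0 + ((M * D * M⁻¹ : GL (Fin 2) R) : Matrix (Fin 2) (Fin 2) R) 1 1 := by
  -- `M e₀ = (1,1)ᵀ`, hence `M⁻¹ (1,1)ᵀ = e₀`
  have hMe : (M : Matrix (Fin 2) (Fin 2) R) *ᵥ ![1, 0] = ![1, 1] := by
    ext i; fin_cases i <;> simp [Matrix.mulVec, dotProduct, Fin.sum_univ_two, hM0, hM1]
  have hMinv : ((M⁻¹ : GL (Fin 2) R) : Matrix (Fin 2) (Fin 2) R) *ᵥ ![1, 1] = ![1, 0] := by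
    rw [← hMe, Matrix.mulVec_mulVec, ← Units.val_mul, inv_mul_cancel, Units.val_one, Matrix.one_mulVec]
  have hDe : (D : Matrix (Fin 2) (Fin 2) R) *ᵥ ![1, 0] = (D : Matrix (Fin 2) (Fin 2) R) 0 0 • ![1, 0] := by
    ext i; fin_cases i <;> simp [Matrix.mulVec, dotProduct, Fin.sum_univ_two, hD10]
  have hu : ((M * D * M⁻¹ : GL (Fin 2) R) : Matrix (Fin 2) (Fin 2) R) *ᵥ ![1, 1] = (D : Matrix (Fin 2) (Fin 2) R) 0 0 • ![1, 1] := by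
    rw [Units.val_mul, Units.val_mul, ← Matrix.mulVec_mulVec, ← Matrix.mulVec_mulVec, hMinv, hDe, Matrix.mulVec_smul, hMe]
  have h0 := congrFun hu 0
  have h1 := congrFun hu 1
  simp only [Matrix.mulVec, dotProduct, Fin.sum_univ_two, Matrix.cons_val_zero, Matrix.cons_val_one,
    mul_one, Pi.smul_apply, smul_eq_mul] at h0 h1
  rw [h0, h1]

end Summit.HodgeConjecture.HodgeConjecture.Cruxes.H413.E2SWDilateBoundCM

end
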